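import Literature.AlgebraicGeometry.Resolution.AlterationsThreePointExtension
import Literature.AlgebraicGeometry.Resolution.AlterationsStableModelSmoothOpen
import Literature.AlgebraicGeometry.Resolution.AlterationsStrictTransformModel
import Literature.AlgebraicGeometry.Resolution.LiuFlatIntegral
import HarnessLib

/-!
# De Jong's alteration theorem: 4.18–4.21 proper (the rational map `β` extends after a modification) as a named fact; the transport of (vi) f), g) along it PROVED

Topic: `Literature/AlgebraicGeometry/Resolution`. Companion to `AlterationsThreePointExtension.lean`,
which vendors de Jong 1996, 4.18–4.21 together with the remarks of 4.16/4.17 that (vi) f), g)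
pass to the strict transform as ONE named fact `DeJong1996ThreePointExtension` (for a fibred
pair with (vi) e), f), g): a projective modification `ψ : Y' → Y` such that every strict
transform `(X', ι)` as in 4.15 has (vi) f) + g) with `β` extended), and proves from it and 4.15
(`DeJong1996StrictTransform`) the node `DeJong1996ModelExtensionReduction`
(`AlterationsModelExtension.lean`):

> "4.21. […] We conclude that the properties a)–c), e) and g) on data `X → S`, `σᵢ` as in 4.18
> imply that the rational map `β` extends to a birational morphism `β : 𝒞 → X`, at least after
> replacing `S` by a modification and `𝒞` and `X` by their strict transforms.
> 4.22. […] We apply the results of 4.18–4.21 and find a modification `ψ : Y' → Y`, such that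
> `β'` extends. Once again using 4.15 we may replace `Y` by `Y'`, etc., and assume that `β`
> extends to `β : 𝒞 → X` and we still have (i)–(iv), (vi) a)–g)." (p. 74)

This file cuts `DeJong1996ThreePointExtension` once more, separating the deep statement from
the bookkeeping, and PROVES the bookkeeping:

* NAMED FACT `DeJong1996RationalMapExtension` — **4.18–4.21 proper, on the data of 4.18**: for
  `f : X → S` proper between integral schemes, `S` a projective variety over a field, sections
  `σᵢ` with a)–c), e), and g) a pointed semi-stable `(p : 𝒞 → S, τ)` with an `S`-isomorphism
  `β : 𝒞_U ⥲ X_U` over a non-empty open `U` matching the sections, there are a projective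
  modification `ψ : S' → S` and an `S'`-MORPHISM `β̃ : 𝒞 ×_S S' → X ×_S S'` extending the base
  change of `β` (equal to `pr_𝒞 ≫ β` on `𝒞 ×_S ψ⁻¹(U)`, an isomorphism over `ψ⁻¹(U)`) and
  mapping the pulled-back sections `τ'ᵢ` to the pulled-back sections `σ'ᵢ`. No presentation of
  the strict transform `X'` of `X` enters: `X' ↪ X ×_S S'` is a closed subscheme containing the
  image of the reduced `𝒞 ×_S S'`, so this is the printed "`β` extends to a birational morphism
  `β : 𝒞' → X'`";
* PROVED, **the transport of (vi) f) + g) WITH `β` EXTENDED to the strict transform**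
  (`DeJong1996.StrictTransform.isUnionOfSectionsWithExtendedModel`; 4.16: "(vi) f) is also
  preserved by alterations as in 4.15", 4.17: "(vi) g) is preserved by operations as in 4.15, by
  putting `𝒞' = 𝒞 ×_Y Y'`, etc.", with the open `U` shrunk into the locus over which `f` is
  smooth, 4.17/(vi) c)): the model `(𝒞 → Y, τ)` is a pre-semi-stable pair for `D = Y ∖ W`, `W`
  the open of 4.17 over which `f` — hence `p ≅ f` there — is smooth
  (`DeJong1996.FibredPair.exists_smooth_morphismRestrict_le`, `smooth_morphismRestrict_of_iso_comp`,
  `DeJong1996.IsPointedSemiStableCurve.preSemiStablePair_of_smooth`), so `𝒳 = 𝒞 ×_Y Y'` is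
  integral (Liu 2002, 4.3.8, proved: `Liu2002IntegralOfFlat_holds` through
  `DeJong1996.PreSemiStablePair.isIntegral_pullback_of_liu`) and projective over `k`, and
  `(𝒳 → Y', τ')` is a pointed semi-stable curve (`DeJong1996.IsPointedSemiStableCurve.baseChange`);
  `β̃` factors as `β' ≫ ι` through the surjective closed immersion `ι : X' → X ×_Y Y'`
  (`IsClosedImmersion.liftOfRange`, `𝒳` being reduced); over `ψ⁻¹(W)` the target open is
  isomorphic to an open of `𝒳`, hence reduced, so `ι` is an isomorphism there and with it `β'`,
  and `f' = ι ≫ pr_{Y'}` is smooth over `ψ⁻¹(W)`; the sections `σ'ᵢ` of `f'`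
  (`DeJong1996.StrictTransform.sect`, `AlterationsStrictTransformModel.lean`) satisfy
  `τ'ᵢ ≫ β' = σ'ᵢ`, are pairwise distinct, and `Z' = ⋃ σ'ᵢ(Y')`;
* PROVED: `DeJong1996ThreePointExtension.of_rationalMapExtension` — the named fact of
  `AlterationsThreePointExtension.lean` follows from `DeJong1996RationalMapExtension` — and the
  composites `DeJong1996ModelExtensionReduction.of_rationalMapExtension_of_strictTransform`,
  `DeJong1996StableModelToMorphism.of_rationalMapExtension_of_strictTransform`.

So below `DeJong1996ModelExtensionReduction` the live named inputs are
`DeJong1996RationalMapExtension` (4.18–4.21) and `DeJong1996StrictTransform` (4.15). The former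
is the node to decompose further: the strict transform and flattening of 2.18–2.19
(`StrictTransform.lean`: `strictTransform`, `DeJong1996StrictTransformFlatLocus`,
`DeJong1996StrictTransformModification`, `DeJong1996Flattening`), the closure `T` of the graph
of `β`, Lemma 4.20 (Stein factorisation; quasi-finiteness of `pr₁ : T → 𝒞` from three labelled
smooth points: Case 1 uses that the fibres of `𝒞` are nodal, Case 2 that the labelled points
are smooth points of the fibres — so the pointed semi-stable rendering of (vi) g) suffices),
and 4.21 (a finite birational morphism onto the normal `𝒞` — Serre's criterion — is an
isomorphism, `isIso_of_isFinite_of_isBirational`, `FiniteBirationalNormal.lean`).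

## Sources

* A. J. de Jong, *Smoothness, semi-stability and alterations*, Publ. Math. IHÉS 83 (1996) 51–93:
  2.17–2.21 (pp. 59–61), Thm. 4.1, 4.4 (p. 66), 4.15–4.17 (pp. 71–72), 4.18–4.22 (pp. 72–74),
  5.14, 5.16 (p. 81).
* Q. Liu, *Algebraic Geometry and Arithmetic Curves*, OUP (2002), Prop. 4.3.8.
-/

noncomputable section

open CategoryTheory CategoryTheory.Limits AlgebraicGeometry TopologicalSpace Topology

namespace Literature.AlgebraicGeometry.Resolution

universe u

/-! ## 4.18–4.21 proper as a named fact -/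

/-- NAMED FACT — **de Jong 1996, 4.18–4.21: after a modification of the base, the rational map
`β` extends to a morphism (the three-point lemma).** "4.18. We want to prove that the rational
map `β` extends to a morphism of `𝒞` into `X`, perhaps after replacing `Y` by a modification.
Since we will need a similar statement later on we prove the result in a slightly more general
situation. Suppose we are given a proper morphism `f : X → S` of integral excellent schemes,
with sections `σ₁, …, σₙ` satisfying the following properties: a) All fibres of `f` are
nonempty, geometrically connected and equidimensional of dimension 1. b) The smooth locus of
`f` is dense in all fibres. c) The generic fibre of `f` is smooth. e) For all geometric points
`s̄` of `S` and any irreducible component `C` of `X_s̄` we have for `Z = ⋃ σᵢ(S)` that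
`# sm(X/Y) ∩ C ∩ Z ≥ 3`. g) There exist a stable `n`-pointed curve `(𝒞, τ₁, …, τₙ)` over `S`,
a nonempty open subscheme `U ⊂ S` and an isomorphism `β : 𝒞_U → X_U` mapping the section
`τᵢ|_U` to the section `σᵢ|_U`. […] 4.21. […] We conclude that the properties a)–c), e) and
g) on data `X → S`, `σᵢ`, as in 4.18 imply that the rational map `β` extends to a birational
morphism `β : 𝒞 → X`, at least after replacing `S` by a modification and `𝒞` and `X` by their
strict transforms." (pp. 72–74; the modification is the flattening blow-up of 2.19/[22] for
`X` and for the closure `T` of the graph of `β`, followed by the normalisation of the base,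
4.18 h), i); 4.19–4.21 then show `pr₁ : T → 𝒞` is finite and birational onto the normal `𝒞`,
hence an isomorphism.)

Rendered in the special case used in 4.22 (and sufficient for it): the base `S` is a
projective variety over a field `k` (integral, `IsProjectiveOver`; such an `S` is excellent),
`X` is integral and, like `𝒞`, projective over `k` (as (iii) and (vi) g) record for the pair;
then the flattening 2.19 is available through the Hilbert scheme, `DeJong1996Flattening`,
`StrictTransform.lean`), `f` is proper with a)–c) (`DeJong1996.IsCurveFibration f`), e)
(`DeJong1996.HasThreeSmoothPoints f (⋃ᵢ σᵢ(S))`), and g) in the rendering of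
`DeJong1996.HasPointedSemiStableModel`: `(p : 𝒞 → S, τ)` a pointed semi-stable curve
(`DeJong1996.IsPointedSemiStableCurve`; of "stable `n`-pointed" Lemma 4.20 uses only that the
fibres are nodal — Case 1 — and that the labelled points `τᵢ(s)` are pairwise distinct smooth
points of the fibre — Case 2 —, and 4.21 only the semi-stability of `𝒞 → S`) with `𝒞`
integral (as recorded in (vi) g); in the text `T`, hence `𝒞 ≅ T`, is integral), `U ⊆ S` a
non-empty open and `β : p⁻¹(U) ⥲ f⁻¹(U)` an isomorphism over `S` carrying `τᵢ|_U` to `σᵢ|_U`.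
Conclusion: there are an integral `S'`, projective over `k`, a modification `ψ : S' → S`
(`IsModification`, 2.17; the blow-ups of 2.19 and the normalisation are projective over `S`),
and — with `𝒞' = 𝒞 ×_S S'` and its pulled-back sections `τ'ᵢ = (τᵢ ∘ ψ, 𝟙)`, which 4.17/4.22
take as the new model ("by putting `𝒞' = 𝒞 ×_Y Y'`, etc.") — an `S'`-morphism
`β̃ : 𝒞 ×_S S' → X ×_S S'` which extends the base change of `β` (it agrees with
`pr_𝒞 ≫ β` on `𝒞 ×_S ψ⁻¹(U)` and is an isomorphism over `ψ⁻¹(U)`) and maps `τ'ᵢ` to the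
pulled-back section `(σᵢ ∘ ψ, 𝟙)` ("`β : 𝒞 → X` mapping `τᵢ` to `σᵢ`", 5.16). The strict
transform `X'` of `X` (2.18; here the reduction of `X ×_S S'`, 4.15) is a closed subscheme of
`X ×_S S'` containing the image of the reduced `𝒞'`, so this is the printed "`β` extends to a
birational morphism `β : 𝒞' → X'`" without fixing a presentation of `X'`
(cf. `DeJong1996.StrictTransform.isUnionOfSectionsWithExtendedModel`). Users take
`(h : DeJong1996RationalMapExtension)`; it is a node to decompose further (2.18–2.19:
`StrictTransform.lean`; Lemma 4.20; 4.21 with Serre's criterion and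
`isIso_of_isFinite_of_isBirational`). The named fact `DeJong1996ThreePointExtension`
(`AlterationsThreePointExtension.lean`: the same together with the transport of (vi) f), g) to
the strict transform) follows from it (`DeJong1996ThreePointExtension.of_rationalMapExtension`).
[cite: DeJong1996, 4.18–4.21, pp. 72–74] -/
def DeJong1996RationalMapExtension : Prop :=
  ∀ (k : Type u) [Field k] (X S C : Scheme.{u}) [IsIntegral X] [IsIntegral S] [IsIntegral C]
    (f : X ⟶ S) [IsProper f] [LocallyOfFinitePresentation f] (g : S ⟶ Spec (.of k)) (n : ℕ)
    (σ : Fin n → (S ⟶ X)) (p : C ⟶ S) (τ : Fin n → (S ⟶ C)) (U : S.Opens)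
    (β : ((p ⁻¹ᵁ U : C.Opens) : Scheme.{u}) ⟶ (f ⁻¹ᵁ U : X.Opens))
    (hσ : ∀ i, σ i ≫ f = 𝟙 S) (hpt : DeJong1996.IsPointedSemiStableCurve p τ),
    Literature.AlgebraicGeometry.Motives.IsProjectiveOver (Over.mk g) →
      Literature.AlgebraicGeometry.Motives.IsProjectiveOver (Over.mk (f ≫ g)) →
        Literature.AlgebraicGeometry.Motives.IsProjectiveOver (Over.mk (p ≫ g)) →
          DeJong1996.IsCurveFibration f →
            DeJong1996.HasThreeSmoothPoints f (⋃ i, Set.range (σ i)) →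
              (U : Set S).Nonempty → IsIso β → β ≫ (f ⁻¹ᵁ U).ι ≫ f = (p ⁻¹ᵁ U).ι ≫ p →
                (∀ i, ∃ t : (U : Scheme.{u}) ⟶ (p ⁻¹ᵁ U : C.Opens),
                    t ≫ (p ⁻¹ᵁ U).ι = U.ι ≫ τ i ∧ t ≫ β ≫ (f ⁻¹ᵁ U).ι = U.ι ≫ σ i) →
                  ∃ (S' : Scheme.{u}) (_ : IsIntegral S') (ψ : S' ⟶ S)
                    (β' : pullback p ψ ⟶ pullback f ψ),
                    IsModification ψ ∧
                      Literature.AlgebraicGeometry.Motives.IsProjectiveOver (Over.mk (ψ ≫ g)) ∧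
                        β' ≫ pullback.snd f ψ = pullback.snd p ψ ∧
                          IsIso (β' ∣_ (pullback.snd f ψ) ⁻¹ᵁ (ψ ⁻¹ᵁ U)) ∧
                            (∀ i, DeJong1996.PreSemiStablePair.pullbackSection hpt.comp_eq_id ψ i ≫
                                β' = DeJong1996.PreSemiStablePair.pullbackSection hσ ψ i) ∧
                              (pullback.fst p ψ ⁻¹ᵁ (p ⁻¹ᵁ U)).ι ≫ β' ≫ pullback.fst f ψ =
                                (pullback.fst p ψ ∣_ p ⁻¹ᵁ U) ≫ β ≫ (f ⁻¹ᵁ U).ι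

/-! ## Smoothness of the model over the open of 4.17 -/

/-- If `p|_U : 𝒞_U → U` is an isomorphism `β : 𝒞_U ⥲ X_U` followed by `f|_U`, and `f` is smooth
over an open `W ≤ U`, then `p` is smooth over `W` (`p|_U|_{U.ι⁻¹W} ≅ p|_W`, and likewise for
`f`). [folklore] -/
theorem smooth_morphismRestrict_of_iso_comp {C X Y : Scheme.{u}} {p : C ⟶ Y} {f : X ⟶ Y}
    {U W : Y.Opens} (β : ((p ⁻¹ᵁ U : C.Opens) : Scheme.{u}) ⟶ (f ⁻¹ᵁ U : X.Opens)) [IsIso β]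
    (hcomm : β ≫ (f ⁻¹ᵁ U).ι ≫ f = (p ⁻¹ᵁ U).ι ≫ p) (hWU : W ≤ U) [Smooth (f ∣_ W)] :
    Smooth (p ∣_ W) := by
  -- `p|_U = β ≫ f|_U`
  have e1 : p ∣_ U = β ≫ f ∣_ U := by
    rw [← cancel_mono U.ι, Category.assoc, morphismRestrict_ι, morphismRestrict_ι]
    exact hcomm.symm
  have hW : U.ι ''ᵁ (U.ι ⁻¹ᵁ W) = W := ι_image_preimage_eq_of_le hWU
  -- `f|_U|_{U.ι⁻¹ W} ≅ f|_W` is smooth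
  haveI h2 : Smooth (f ∣_ U ∣_ (U.ι ⁻¹ᵁ W)) :=
    (MorphismProperty.arrow_mk_iso_iff @Smooth (morphismRestrictRestrict f U (U.ι ⁻¹ᵁ W))).mpr
      ((MorphismProperty.arrow_mk_iso_iff @Smooth (morphismRestrictEq f hW)).mpr ‹_›)
  -- hence so is `p|_U|_{U.ι⁻¹ W} = β|_… ≫ f|_U|_{U.ι⁻¹ W}`
  have h3 : ∀ q : ((p ⁻¹ᵁ U : C.Opens) : Scheme.{u}) ⟶ U, q = β ≫ f ∣_ U →
      Smooth (q ∣_ (U.ι ⁻¹ᵁ W)) := by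
    rintro _ rfl
    rw [morphismRestrict_comp]
    have i1 : Smooth (β ∣_ (f ∣_ U) ⁻¹ᵁ (U.ι ⁻¹ᵁ W)) := inferInstance
    exact MorphismProperty.comp_mem @Smooth _ _ i1 h2
  have h4 := h3 _ e1
  exact (MorphismProperty.arrow_mk_iso_iff @Smooth (morphismRestrictEq p hW)).mp
    ((MorphismProperty.arrow_mk_iso_iff @Smooth (morphismRestrictRestrict p U (U.ι ⁻¹ᵁ W))).mp h4)

namespace DeJong1996

/-! ## Pointed semi-stable curves: base change, and the model as a pre-semi-stable pair -/

namespace IsPointedSemiStableCurve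

/-- **Pointed semi-stable curves are preserved by base change** ("by putting `𝒞' = 𝒞 ×_Y Y'`,
etc.", 4.17): the pulled-back family `𝒞 ×_S S' → S'` with the sections
`τ'ᵢ = (τᵢ ∘ ψ, 𝟙)` is a pointed semi-stable curve — semi-stability is
`IsSemiStableCurve.baseChange` (Liu 2002, 10.3.15 (a)); disjointness and the smooth
neighbourhoods of the sections come through the cartesian squares over `𝒞 ×_S S' → 𝒞`.
[cite: DeJong1996, 4.17, p. 72] -/
theorem baseChange {C S S' : Scheme.{u}} {p : C ⟶ S} {n : ℕ} {τ : Fin n → (S ⟶ C)}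
    (h : IsPointedSemiStableCurve p τ) (ψ : S' ⟶ S) :
    IsPointedSemiStableCurve (pullback.snd p ψ)
      (PreSemiStablePair.pullbackSection h.comp_eq_id ψ) where
  isSemiStableCurve := h.isSemiStableCurve.baseChange ψ
  comp_eq_id i := PreSemiStablePair.pullbackSection_snd h.comp_eq_id ψ i
  pairwise_disjoint := by
    intro i j hij
    refine Set.disjoint_left.mpr ?_
    rintro x ⟨y, rfl⟩ ⟨y', hy'⟩
    have h1 : pullback.fst p ψ (PreSemiStablePair.pullbackSection h.comp_eq_id ψ i y) ∈
        Set.range (τ i) := by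
      rw [← Scheme.Hom.comp_apply, PreSemiStablePair.pullbackSection_fst]
      exact ⟨ψ y, rfl⟩
    have h2 : pullback.fst p ψ (PreSemiStablePair.pullbackSection h.comp_eq_id ψ j y') ∈
        Set.range (τ j) := by
      rw [← Scheme.Hom.comp_apply, PreSemiStablePair.pullbackSection_fst]
      exact ⟨ψ y', rfl⟩
    rw [hy'] at h2
    exact Set.disjoint_left.mp (h.pairwise_disjoint hij) h1 h2
  exists_smooth i := by
    obtain ⟨V, hV, hsm⟩ := h.exists_smooth i
    refine ⟨pullback.fst p ψ ⁻¹ᵁ V, ?_, ι_comp_pullback_snd_of_ι_comp (P := @Smooth) p ψ V hsm⟩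
    rintro _ ⟨y, rfl⟩
    show pullback.fst p ψ (PreSemiStablePair.pullbackSection h.comp_eq_id ψ i y) ∈ V
    rw [← Scheme.Hom.comp_apply, PreSemiStablePair.pullbackSection_fst]
    exact hV ⟨ψ y, rfl⟩

/-- **The model of (vi) g) is a pre-semi-stable pair** for `D = Y ∖ W`, `W` any non-empty open
over which `p` is smooth (e.g. the open of 4.17 over which `f`, hence `p ≅ f` there, is
smooth): `𝒞` integral and projective over `k`, `Y` a projective variety, `(p, τ)` a pointed
semi-stable curve. This is how 4.22 views `(𝒞, τ₁(Y) ∪ … ∪ τₙ(Y) ∪ f⁻¹(D))`.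
[cite: DeJong1996, 4.22, p. 74] -/
theorem preSemiStablePair_of_smooth {k : Type u} [Field k] {C Y : Scheme.{u}} [IsIntegral C]
    [IsIntegral Y] {p : C ⟶ Y} {g : Y ⟶ Spec (.of k)} {n : ℕ} {τ : Fin n → (Y ⟶ C)}
    (h : IsPointedSemiStableCurve p τ)
    (hproj : Literature.AlgebraicGeometry.Motives.IsProjectiveOver (Over.mk (p ≫ g)))
    (hprojY : Literature.AlgebraicGeometry.Motives.IsProjectiveOver (Over.mk g)) {W : Y.Opens}
    (hW : (W : Set Y).Nonempty) [Smooth (p ∣_ W)] : PreSemiStablePair p g ((W : Set Y)ᶜ) τ :=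
  have hsm : ∀ V : Y.Opens, V = W → Smooth (p ∣_ V) := by
    rintro V rfl
    infer_instance
  { isIntegral := ‹_›
    isProjectiveOver := hproj
    isIntegral_base := ‹_›
    isProjectiveOver_base := hprojY
    isClosed := W.isOpen.isClosed_compl
    ne_univ := fun huniv => by
      obtain ⟨y, hy⟩ := hW
      have hy' : y ∈ (W : Set Y)ᶜ := huniv ▸ Set.mem_univ y
      exact hy' hy
    isSemiStableCurve := h.isSemiStableCurve
    smooth_morphismRestrict := hsm _ (TopologicalSpace.Opens.ext (compl_compl _))
    comp_eq_id := h.comp_eq_id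
    pairwise_disjoint := h.pairwise_disjoint
    exists_smooth := h.exists_smooth }

end IsPointedSemiStableCurve

/-! ## (vi) f) + g) with `β` extended, for the strict transform -/

namespace StrictTransform

/-- **de Jong 1996, 4.22: "Once again using 4.15 we may replace `Y` by `Y'`, etc., and assume
that `β` extends to `β : 𝒞 → X` and we still have […] (vi) […] f), g)" — PROVED.** Let
`f : X → Y` be separated over the projective variety `Y`, with pairwise distinct sections `σᵢ`
and `Z = ⋃ᵢ σᵢ(Y)`; let `(p : 𝒞 → Y, τ)` be a pointed semi-stable model, `𝒞` integral and
projective over `k`, smooth over the non-empty open `W ⊆ Y` over which `f` is smooth (a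
pre-semi-stable pair for `D = Y ∖ W`); let `ψ : Y' → Y` be dominant and surjective from a
projective variety `Y'` (the modification of 4.18–4.21), `ι : X' ↪ X ×_Y Y'` a surjective
closed immersion (the strict transform of 4.15), and `β̃ : 𝒞 ×_Y Y' → X ×_Y Y'` a
`Y'`-morphism which is an isomorphism over `ψ⁻¹(W)` and maps the pulled-back sections `τ'ᵢ`
to the pulled-back sections `(σᵢ ∘ ψ, 𝟙)` (the output of 4.18–4.21,
`DeJong1996RationalMapExtension`). Then the strict transform `(f' : X' → Y', Z' = φ⁻¹Z)` has
(vi) f) + g) with `β` extended (`IsUnionOfSectionsWithExtendedModel`): `𝒳 = 𝒞 ×_Y Y'` is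
integral (Liu 2002, 4.3.8: `PreSemiStablePair.isIntegral_pullback_of_liu`,
`Liu2002IntegralOfFlat_holds`) and projective over `k` (`isProjectiveOver_pullback`),
`(𝒳 → Y', τ')` is a pointed semi-stable curve (`IsPointedSemiStableCurve.baseChange`), `β̃`
factors as `β' ≫ ι` through the closed immersion `ι` since `𝒳` is reduced
(`IsClosedImmersion.liftOfRange`); over `ψ⁻¹(W)` the open `X ×_Y ψ⁻¹(W) ≅ 𝒳|_{ψ⁻¹(W)}` is
reduced, so `ι` is an isomorphism there (`isIso_morphismRestrict_of_isClosedImmersion_of_surjective`),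
hence `β'` is an isomorphism over `ψ⁻¹(W)` and `f' = ι ≫ pr_{Y'}` is smooth over `ψ⁻¹(W)`
(`pr_{Y'}` is, by base change); the sections `σ'ᵢ` of `f'` (`StrictTransform.sect`, 4.16)
satisfy `τ'ᵢ ≫ β' = σ'ᵢ` (`ι` is a monomorphism), are pairwise distinct, and
`Z' = ⋃ᵢ σ'ᵢ(Y')` (`StrictTransform.preimage_iUnion_range`).
[cite: DeJong1996, 4.15–4.17 and 4.22, pp. 71–74] -/
theorem isUnionOfSectionsWithExtendedModel {k : Type u} [Field k]
    {X Y Y' X' C : Scheme.{u}} [IsIntegral Y] [IsIntegral Y'] {f : X ⟶ Y} [IsSeparated f]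
    {g : Y ⟶ Spec (.of k)} [IsSeparated g] {ψ : Y' ⟶ Y} [IsDominant ψ] [Surjective ψ]
    (ι : X' ⟶ Limits.pullback f ψ) [IsClosedImmersion ι] [Surjective ι] {n : ℕ}
    {σ : Fin n → (Y ⟶ X)} (hσ : ∀ i, σ i ≫ f = 𝟙 Y) (hinj : Function.Injective σ) {Z : Set X}
    (hZ : Z = ⋃ i, Set.range (σ i)) {p : C ⟶ Y} {τ : Fin n → (Y ⟶ C)} {W : Y.Opens}
    (hpre : PreSemiStablePair p g ((W : Set Y)ᶜ) τ) (hW : (W : Set Y).Nonempty)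
    (hfW : Smooth (f ∣_ W))
    (hY' : Literature.AlgebraicGeometry.Motives.IsProjectiveOver (Over.mk (ψ ≫ g)))
    (βt : Limits.pullback p ψ ⟶ Limits.pullback f ψ)
    (hover : βt ≫ pullback.snd f ψ = pullback.snd p ψ)
    (hiso : IsIso (βt ∣_ (pullback.snd f ψ) ⁻¹ᵁ (ψ ⁻¹ᵁ W)))
    (hsec : ∀ i, PreSemiStablePair.pullbackSection hpre.comp_eq_id ψ i ≫ βt =
      PreSemiStablePair.pullbackSection hσ ψ i) :
    IsUnionOfSectionsWithExtendedModel (ι ≫ pullback.snd f ψ) (ψ ≫ g)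
      ((ι ≫ pullback.fst f ψ) ⁻¹' Z) := by
  haveI := hpre.isIntegral
  haveI := hfW
  -- `𝒳 = 𝒞 ×_Y Y'` is integral (Liu 2002, 4.3.8)
  haveI : IsIntegral (Limits.pullback p ψ) :=
    hpre.isIntegral_pullback_of_liu Liu2002IntegralOfFlat_holds ψ
  -- `βt` factors through the surjective closed immersion `ι`
  obtain ⟨β', hβ'⟩ : ∃ β' : Limits.pullback p ψ ⟶ X', β' ≫ ι = βt :=
    ⟨IsClosedImmersion.liftOfRange ι βt
        (by rw [Set.range_eq_univ.mpr ι.surjective]; exact Set.subset_univ _),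
      IsClosedImmersion.liftOfRange_fac _ _ _⟩
  subst hβ'
  subst hZ
  refine IsUnionOfSectionsWithExtendedModel.mk' (sect_injective ι hσ hinj) (sect_snd ι hσ)
    (preimage_iUnion_range ι hσ) ?_
  -- over the open `V = pr_{Y'}⁻¹(ψ⁻¹ W)` of `X ×_Y Y'`, `β' ≫ ι` is an isomorphism, and `V` is
  -- reduced (isomorphic to an open of the integral `𝒳`), so `ι` is an isomorphism over `V`
  haveI := hiso
  haveI : IsReduced ((pullback.snd f ψ ⁻¹ᵁ (ψ ⁻¹ᵁ W) : (Limits.pullback f ψ).Opens) : Scheme.{u}) := by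
    haveI : IsReduced (((β' ≫ ι) ⁻¹ᵁ (pullback.snd f ψ ⁻¹ᵁ (ψ ⁻¹ᵁ W)) :
        (Limits.pullback p ψ).Opens) : Scheme.{u}) :=
      isReduced_of_isOpenImmersion ((β' ≫ ι) ⁻¹ᵁ (pullback.snd f ψ ⁻¹ᵁ (ψ ⁻¹ᵁ W))).ι
    exact isReduced_of_isOpenImmersion (inv ((β' ≫ ι) ∣_ pullback.snd f ψ ⁻¹ᵁ (ψ ⁻¹ᵁ W)))
  haveI hιV : IsIso (ι ∣_ pullback.snd f ψ ⁻¹ᵁ (ψ ⁻¹ᵁ W)) :=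
    isIso_morphismRestrict_of_isClosedImmersion_of_surjective ι _
  -- `β'` is an isomorphism over `ψ⁻¹(W)`: `(β' ≫ ι)|_V = β'|_{ι⁻¹V} ≫ ι|_V`
  have hβ'V : IsIso (β' ∣_ ι ⁻¹ᵁ (pullback.snd f ψ ⁻¹ᵁ (ψ ⁻¹ᵁ W))) :=
    IsIso.of_isIso_fac_right (f := ι ∣_ pullback.snd f ψ ⁻¹ᵁ (ψ ⁻¹ᵁ W)) (hh := hiso)
      (morphismRestrict_comp β' ι (pullback.snd f ψ ⁻¹ᵁ (ψ ⁻¹ᵁ W))).symm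
  -- `pr_{Y'}` is smooth over `ψ⁻¹(W)`, hence so is `f' = ι ≫ pr_{Y'}`
  haveI : Smooth (pullback.snd f ψ ∣_ ψ ⁻¹ᵁ W) :=
    morphismRestrict_pullback_snd_of_morphismRestrict (P := @Smooth) f ψ W hfW
  have hsmooth : Smooth ((ι ≫ pullback.snd f ψ) ∣_ ψ ⁻¹ᵁ W) := by
    rw [morphismRestrict_comp]
    exact MorphismProperty.comp_mem @Smooth _ _
      (inferInstance : Smooth (ι ∣_ pullback.snd f ψ ⁻¹ᵁ (ψ ⁻¹ᵁ W)))
      (inferInstance : Smooth (pullback.snd f ψ ∣_ ψ ⁻¹ᵁ W))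
  -- `ψ⁻¹(W)` is non-empty
  have hne : ((ψ ⁻¹ᵁ W : Y'.Opens) : Set Y').Nonempty := by
    obtain ⟨y, hy⟩ := hW
    obtain ⟨y', rfl⟩ := ψ.surjective y
    exact ⟨y', hy⟩
  refine ⟨Limits.pullback p ψ, pullback.snd p ψ,
    PreSemiStablePair.pullbackSection hpre.comp_eq_id ψ, ψ ⁻¹ᵁ W, β', inferInstance,
    isProjectiveOver_pullback p g ψ (ψ ≫ g) rfl hpre.isProjectiveOver hY',
    hpre.isPointedSemiStableCurve.baseChange ψ, hne, hsmooth, ?_, hβ'V, fun i => ?_⟩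
  · rw [← Category.assoc]
    exact hover
  · rw [← cancel_mono ι, Category.assoc, sect_ι]
    exact hsec i

end StrictTransform

end DeJong1996

/-! ## `DeJong1996ThreePointExtension` from `DeJong1996RationalMapExtension` -/

/-- **de Jong 1996, 4.18–4.21 with the transport of (vi) f), g) (`DeJong1996ThreePointExtension`,
`AlterationsThreePointExtension.lean`) from 4.18–4.21 proper (`DeJong1996RationalMapExtension`)
— PROVED.** Given a fibred pair `(X, Z)` over `Y → Spec k` with (vi) e) and (vi) f) + g) —
sections `σᵢ`, `Z = ⋃ σᵢ(Y)`, a pointed semi-stable model `(𝒞 → Y, τ, U, β)` —: shrink `U` to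
a non-empty open `W` over which `f` is smooth (4.17, `FibredPair.exists_smooth_morphismRestrict_le`),
so that the model is a pre-semi-stable pair for `D = Y ∖ W`
(`IsPointedSemiStableCurve.preSemiStablePair_of_smooth`, `smooth_morphismRestrict_of_iso_comp`);
"apply the results of 4.18–4.21 and find a modification `ψ : Y' → Y`, such that `β'` extends"
(`DeJong1996RationalMapExtension`, applied to `f`, proper as a morphism of projective
`k`-schemes); then every strict transform `(X', ι)` along `ψ` has (vi) f) + g) with `β`
extended, over `ψ⁻¹(W)` (`StrictTransform.isUnionOfSectionsWithExtendedModel`, the isomorphism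
clause being inherited by the smaller open, `morphismRestrict_of_le`).
[cite: DeJong1996, 4.16–4.22, pp. 71–74] -/
theorem DeJong1996ThreePointExtension.of_rationalMapExtension
    (h₁ : DeJong1996RationalMapExtension.{u}) : DeJong1996ThreePointExtension.{u} := by
  intro k _ _ X Y _ f _ g Z hP h3 hfg
  obtain ⟨n, σ, hinj, hσ, hmod, hZ⟩ := hfg
  obtain ⟨C, p, τ, U, β, hC, hprojC, hpt, hUne, hβ, hcomm, hsect⟩ := hmod
  subst hZ
  haveI := hP.isIntegral
  haveI := hC
  haveI := hβ
  haveI : IsProper f := hP.isProper_fibration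
  haveI : IsProper g :=
    Literature.AlgebraicGeometry.Motives.IsProjectiveOver.isProper (X := Over.mk g)
      hP.isProjectiveOver_base
  -- 4.17: a non-empty open `W ⊆ U` over which `f`, hence the model, is smooth
  obtain ⟨W, hWU, hWne, hfW⟩ := hP.exists_smooth_morphismRestrict_le U hUne
  haveI := hfW
  haveI : Smooth (p ∣_ W) := smooth_morphismRestrict_of_iso_comp β hcomm hWU
  have hpre : DeJong1996.PreSemiStablePair p g ((W : Set Y)ᶜ) τ :=
    hpt.preSemiStablePair_of_smooth hprojC hP.isProjectiveOver_base hWne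
  -- 4.18–4.21: a modification `ψ : Y' → Y` over which `β` extends
  obtain ⟨Y', hY', ψ, β', hψ, hprojY', hover, hiso, hsec, -⟩ :=
    h₁ k X Y C f g n σ p τ U β hσ hpt hP.isProjectiveOver_base hP.isProjectiveOver hprojC
      hP.isCurveFibration h3 hUne hβ hcomm hsect
  haveI := hY'
  haveI : IsDominant ψ := hψ.isDominant
  haveI : Surjective ψ := hψ.isAlteration.surjective
  refine ⟨Y', hY', ψ, hprojY', hψ, fun X' ι hι hιs _ => ?_⟩
  -- (vi) f) + g) with `β` extended for the strict transform, over the smaller open `ψ⁻¹(W)`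
  have hisoW : IsIso (β' ∣_ (pullback.snd f ψ) ⁻¹ᵁ (ψ ⁻¹ᵁ W)) := by
    have hle : pullback.snd f ψ ⁻¹ᵁ (ψ ⁻¹ᵁ W) ≤ pullback.snd f ψ ⁻¹ᵁ (ψ ⁻¹ᵁ U) :=
      fun x hx => hWU hx
    exact (MorphismProperty.isomorphisms.iff _).mp
      (morphismRestrict_of_le (MorphismProperty.isomorphisms Scheme.{u}) β' hle
        ((MorphismProperty.isomorphisms.iff _).mpr hiso))
  exact DeJong1996.StrictTransform.isUnionOfSectionsWithExtendedModel ι hσ hinj rfl hpre hWne hfW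
    hprojY' β' hover hisoW hsec

/-! ## Composites -/

/-- **4.18–4.21 with the first two sentences of 4.22 (`DeJong1996ModelExtensionReduction`) from
4.18–4.21 proper (`DeJong1996RationalMapExtension`) and the strict transform 4.15
(`DeJong1996StrictTransform`)**, through `DeJong1996ModelExtensionReduction.of_threePoint_of_strictTransform`
(`AlterationsThreePointExtension.lean`). [cite: DeJong1996, 4.15–4.22, pp. 71–74] -/
theorem DeJong1996ModelExtensionReduction.of_rationalMapExtension_of_strictTransform
    (h₁ : DeJong1996RationalMapExtension.{u}) (h₂ : DeJong1996StrictTransform.{u}) :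
    DeJong1996ModelExtensionReduction.{u} :=
  DeJong1996ModelExtensionReduction.of_threePoint_of_strictTransform
    (DeJong1996ThreePointExtension.of_rationalMapExtension h₁) h₂

/-- The parallel rendering `DeJong1996StableModelToMorphism` (`AlterationsStableModelMorphism.lean`)
of the same node, from 4.18–4.21 proper and 4.15
(`DeJong1996ModelExtensionReduction.iff_stableModelToMorphism`).
[cite: DeJong1996, 4.15–4.22, pp. 71–74] -/
theorem DeJong1996StableModelToMorphism.of_rationalMapExtension_of_strictTransform
    (h₁ : DeJong1996RationalMapExtension.{u}) (h₂ : DeJong1996StrictTransform.{u}) :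
    DeJong1996StableModelToMorphism.{u} :=
  (DeJong1996ModelExtensionReduction.of_rationalMapExtension_of_strictTransform h₁ h₂).stableModelToMorphism

/-- **4.18–4.22a (`DeJong1996StableModelToPreSemiStablePair`) from 4.18–4.21 proper and 4.15**
(the rest of 4.22a is proved in `AlterationsModelExtension.lean`).
[cite: DeJong1996, 4.15–4.22, pp. 71–74] -/
theorem DeJong1996StableModelToPreSemiStablePair.of_rationalMapExtension_of_strictTransform
    (h₁ : DeJong1996RationalMapExtension.{u}) (h₂ : DeJong1996StrictTransform.{u}) :
    DeJong1996StableModelToPreSemiStablePair.{u} :=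
  DeJong1996StableModelToPreSemiStablePair.of_extensionReduction
    (DeJong1996ModelExtensionReduction.of_rationalMapExtension_of_strictTransform h₁ h₂)

end Literature.AlgebraicGeometry.Resolution

end
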